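import Literature.Computability.QuantumComplexity.QFTPhaseProgFP
import Literature.Computability.QuantumComplexity.QFTThresholdsFP
import Literature.Computability.QuantumComplexity.QFTKit
import Literature.Computability.QuantumComplexity.CoreDescBlockFP
import HarnessLib

/-!
# The sizes of the Fourier-stage kit are polynomial-time computable

Topic `Literature/Computability/QuantumComplexity`; an S4 input of the UNIFORMITY of Regev's sampler ([Regev2009, Lemma 3.14,
proof]; Nielsen–Chuang §5.1; Arora–Barak §6.2): the kit `QFTKit.kit k κ` of the Fourier stage has `qR k κ` registers, `qF k κ` flags
and `qT k κ` instruction slots, maxima over the letter programs (`BlockKit.kitR/kitF/kitT k`, on codes in `CoreDescSLPCodes.lean`) and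
over the `κ + 1` controlled-phase programs `SLP.qftPrograms k κ` (`QFTKit.qftR/qftF/qftT`). With the phase program compiled on codes
(`SLP.qftPhaseB_compile_codeFP`, `QFTPhaseProgFP.lean`) and the thresholds on codes (`SLP.codeFP_cosThr/sinThr`, `QFTThresholdsFP.lean`):

* `ulmax : CodeFP (rawE unE) unE BlockKit.lmax` (the maximum of a list of unary numbers);
* `SLP.qftPrograms_compile_codeFP : (1ᵏ, 1^κ) ↦ (qftPrograms k κ).map (·.compile (thrWd k) 0 0)`;
* **`QFTKit.qftR_codeFP`, `qftF_codeFP`, `qftT_codeFP`**, **`QFTKit.qR_codeFP`, `qF_codeFP`, `qT_codeFP : CodeFP (pairE unE unE) unE (fun p => q? p.1 p.2)`**.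

Everything is proved; no named fact is introduced.

## References

* O. Regev, J. ACM 56(6) (2009), Lemma 3.14 (proof) [Regev2009].
* M. A. Nielsen, I. L. Chuang, *Quantum Computation and Quantum Information*, CUP 2010, §5.1 [NielsenChuang2010].
* S. Arora, B. Barak, *Computational Complexity: A Modern Approach*, CUP 2009, §1.3, §6.2 [AroraBarak2009].
-/

noncomputable section

namespace Literature.Computability.QuantumComplexity

open _root_.Computability Complexity Complexity.CodeFP SLP Polynomial

/-- A left fold of `max` is bounded by a common bound. [folklore] -/
theorem foldl_max_le {l : List ℕ} {B b₀ : ℕ} (hb : b₀ ≤ B) (hl : ∀ a ∈ l, a ≤ B) : l.foldl (fun b a => max a b) b₀ ≤ B := by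
  induction l generalizing b₀ with
  | nil => exact hb
  | cons a l ih => exact ih (max_le (hl a (by simp)) hb) fun x hx => hl x (by simp [hx])

/-- **The maximum of a list of unary numbers, in unary.** [cite: AroraBarak2009, §1.3 (bounded loops)] -/
theorem ulmax : CodeFP (rawE unE) unE BlockKit.lmax := by
  have h := foldl₀ (eα := unE) (eβ := unE) (step := fun (a : ℕ) (b : ℕ) => max a b) (b₀ := 0) AJLCore.unMax X (fun l₁ l₂ => by
    rw [eval_X, length_unE]
    refine foldl_max_le (Nat.zero_le _) fun a ha => ?_
    have h := length_item_le_length_rawE unE (List.mem_append_left l₂ ha)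
    rw [length_unE] at h; omega)
  exact (h.comp (AJLCore.rawReverse unE)).congr fun l => by
    show List.foldl (fun b a => max a b) 0 l.reverse = _; rw [List.foldl_reverse]; rfl

/-- The compiled program of denominator `2^m` at precision `k`, on codes from `(1ᵏ, bin m')` with `m = min m' κ`-free form `(1ᵏ, 1ᵐ)`. [folklore] -/
theorem SLP.qftPhase_compile_codeFP :
    CodeFP (pairE unE unE) AJLCore.outBE (fun p => (qftPhaseB p.1 (cosThr p.2 p.1) (sinThr p.2 p.1)).compile (thrWd p.1) 0 0) :=
  (qftPhaseB_compile_codeFP.comp ((fst _ _).pair ((codeFP_cosThr.comp ((snd _ _).pair (fst _ _))).pair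
    (codeFP_sinThr.comp ((snd _ _).pair (fst _ _))))) :)

/-- **The compiled controlled-phase programs, on codes from `(1ᵏ, 1^κ)`.** [cite: Regev2009, Lemma 3.14 (proof)] -/
theorem SLP.qftPrograms_compile_codeFP :
    CodeFP (pairE unE unE) (rawE AJLCore.outBE) (fun p => (qftPrograms p.1 p.2).map fun b => b.compile (thrWd p.1) 0 0) := by
  have hg : CodeFP (pairE (pairE unE unE) natE) AJLCore.outBE
      (fun t => (qftPhaseB t.1.1 (cosThr (min t.2 t.1.2) t.1.1) (sinThr (min t.2 t.1.2) t.1.1)).compile (thrWd t.1.1) 0 0) :=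
    (qftPhase_compile_codeFP.comp ((fst _ _).fst'.pair (unOfNatMin.comp ((fst _ _).snd'.pair (snd _ _)))) :)
  exact ((map hg).comp ((CodeFP.id _).pair (urange.comp (unSucc.comp (snd _ _))))).congr fun p => by
    show (List.range (p.2 + 1)).map _ = _
    rw [qftPrograms, List.map_map]
    refine List.map_congr_left fun m hm => ?_
    dsimp only [id, Function.comp]
    rw [Nat.min_eq_left (Nat.le_of_lt_succ (List.mem_range.1 hm))]

namespace QFTKit

/-- **`(1ᵏ, 1^κ) ↦ 1^{qftR k κ}`.** [folklore] -/
theorem qftR_codeFP : CodeFP (pairE unE unE) unE (fun p => qftR p.1 p.2) :=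
  ((ulmax.comp ((map ((snd _ _).snd'.snd'.fst' : CodeFP (pairE (pairE unE unE) AJLCore.outBE) unE (fun t => t.2.2.2.1))).comp
    ((CodeFP.id _).pair qftPrograms_compile_codeFP))) :).congr fun p => by
    show BlockKit.lmax (List.map _ (List.map _ _)) = _; rw [qftR, List.map_map]; rfl

/-- **`(1ᵏ, 1^κ) ↦ 1^{qftF k κ}`.** [folklore] -/
theorem qftF_codeFP : CodeFP (pairE unE unE) unE (fun p => qftF p.1 p.2) :=
  ((ulmax.comp ((map ((snd _ _).snd'.snd'.snd' : CodeFP (pairE (pairE unE unE) AJLCore.outBE) unE (fun t => t.2.2.2.2))).comp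
    ((CodeFP.id _).pair qftPrograms_compile_codeFP))) :).congr fun p => by
    show BlockKit.lmax (List.map _ (List.map _ _)) = _; rw [qftF, List.map_map]; rfl

/-- **`(1ᵏ, 1^κ) ↦ 1^{qftT k κ}`.** [folklore] -/
theorem qftT_codeFP : CodeFP (pairE unE unE) unE (fun p => qftT p.1 p.2) :=
  ((ulmax.comp ((map ((ulength AJLCore.instrE).comp (snd _ _).fst' :
      CodeFP (pairE (pairE unE unE) AJLCore.outBE) unE (fun t => t.2.1.length))).comp
    ((CodeFP.id _).pair qftPrograms_compile_codeFP))) :).congr fun p => by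
    show BlockKit.lmax (List.map _ (List.map _ _)) = _; rw [qftT, List.map_map]; rfl

/-- **`(1ᵏ, 1^κ) ↦ 1^{qR k κ}`.** [cite: Regev2009, Lemma 3.14 (proof)] -/
theorem qR_codeFP : CodeFP (pairE unE unE) unE (fun p => qR p.1 p.2) :=
  (AJLCore.unMax.comp ((AJLCore.kitR_codeFP.comp (fst _ _)).pair qftR_codeFP) :)

/-- **`(1ᵏ, 1^κ) ↦ 1^{qF k κ}`.** [cite: Regev2009, Lemma 3.14 (proof)] -/
theorem qF_codeFP : CodeFP (pairE unE unE) unE (fun p => qF p.1 p.2) :=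
  (AJLCore.unMax.comp ((AJLCore.kitF_codeFP.comp (fst _ _)).pair qftF_codeFP) :)

/-- **`(1ᵏ, 1^κ) ↦ 1^{qT k κ}`.** [cite: Regev2009, Lemma 3.14 (proof)] -/
theorem qT_codeFP : CodeFP (pairE unE unE) unE (fun p => qT p.1 p.2) :=
  (AJLCore.unMax.comp ((AJLCore.kitT_codeFP.comp (fst _ _)).pair qftT_codeFP) :)

end QFTKit

end Literature.Computability.QuantumComplexity

end
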